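import Summits.QuantumFields.GaugeBoot.SU2PairInversion
import Summits.QuantumFields.GaugeBoot.WordLoop
import Summits.QuantumFields.GaugeBoot.ClassBWords
import HarnessLib

/-!
# `SU(2)` loop variables are blind to the simultaneous inversion of two generating loops
# (gauge-boot, large-`N` supplement 17, part 2)

HONEST FRAMING (cell `pub-gaugeboot`, page 1 of every file): the venture produces certified bounds
on lattice expectations at stated coupling, gauge group, dimension and torus size; NOT a mass gap,
NOT a continuum limit, NOT a string tension; NOT large `N` unless marked CONDITIONAL; NOT
Yang–Mills-summit-bearing (barriers `FixedCouplingUltralocality`, `PerturbativeInvisibility`).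
Lattice combinatorics plus part 1 (`SU2PairInversion`); this file certifies no number.

## Content

Substitution of based loops for the letters of a free-group word: for loops `P i` (`i : ι`) closed at
`x` and a letter list `ℓ : List (ι × Bool)` (Mathlib's `FreeGroup` convention), `Word.subst P ℓ` is
the concatenation of the `P i` / `(P i)⁻¹ = Word.reverse (P i)`; its holonomy is the free-group
evaluation `FreeGroup.lift (hol ∘ P) (FreeGroup.mk ℓ)` (`wordHolonomy_subst`, `wordHolonomyZd_subst`;
any group, torus and `ℤ^d`).  `invLetters ℓ` inverts every letter and KEEPS their order — the
automorphism `a ↦ a⁻¹, b ↦ b⁻¹` of `F₂`, NOT the inversion of the word.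

For the gauge group `SU(2)` and TWO loops `P : Fin 2 → Word d` (part 1, `exists_lift_inv_eq_conj`):
* ★★ `exists_conj_wordHolonomy_subst_invLetters` — for every configuration `U` ONE `g ∈ SU(2)`
  conjugates `hol_x(w(p,q))` to `hol_x(w(p⁻¹,q⁻¹))` for all `w` at once;
* ★★★ `wordLoop_subst_invLetters` (torus) / `wordLoopZd_subst_invLetters` (`ℤ^d`) — **the loop
  variables of `w(p, q)` and `w(p⁻¹, q⁻¹)` are EQUAL AS FUNCTIONS of the configuration**, for every
  word `w ∈ F₂` and every two loops `p, q` based at the same site; hence equal in EVERY state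
  (`wilsonExpectation_wordLoop_subst_invLetters`: every torus, every `β`; on `ℤ^d` every measure).

Meaning for the bootstrap (honest): an infinite family of exact, coupling-independent linear identities
`y[w(p,q)] = y[w(p⁻¹,q⁻¹)]` among `SU(2)` loop variables.  For `w` of length `≤ 4` in `p, q` the two
loops are related by reversal and cyclic rotation, so the identity is already in the symmetry canon
(`LoopClasses`); from length `5` on (`w = p²qp⁻¹q⁻¹`, `p²qpq⁻¹`, …) it relates loops that are in
general NOT related by any lattice symmetry, reversal or rotation (explicit `ℤ²` instance of length `22`
in part 3, `SU2LoopPairInversionExample`).  Each single instance also follows from two applications of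
the `SU(2)` trace identity `tr g tr h = tr(gh) + tr(gh⁻¹)` (`SU2SingleTraceClosure.su2_trace_mul_trace`)
— so a bootstrap that closes double traces at the relevant length implies it — but as a constraint on
single-trace variables it is free: no positivity, no `β`, no double traces.  It is special to TWO loops
and to `N = 2` (part 1 `trace_three_ne`; part 3: an `SU(3)` configuration separating the instance).
[folklore] (Fricke–Klein; Horowitz 1972; Kapovich–Levitt–Schupp–Shpilrain 2007, Prop. 5.3.)
-/

noncomputable section

open MeasureTheory
open Literature.MathematicalPhysics.QuantumFieldTheory
open Literature.MathematicalPhysics.QuantumLattice (LGConfig fundamentalRep_apply)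

namespace Summit.QuantumFields.GaugeBoot

variable {d : ℕ} {ι : Type*}

/-! ## Substitution words and letter inversion (any group) -/

namespace Word

/-- **Substitution of based loops for the letters of a free-group word**: `(i, true) ↦ P i`,
`(i, false) ↦ (P i)⁻¹ = reverse (P i)`, concatenated in order (Mathlib's `FreeGroup.mk` letter
convention). [folklore] -/
def subst (P : ι → Word d) : List (ι × Bool) → Word d
  | [] => []
  | x :: ℓ => cond x.2 (P x.1) (Word.reverse (P x.1)) ++ subst P ℓ

/-- Unfolding lemma. [folklore] -/
@[simp] theorem subst_nil (P : ι → Word d) : subst P [] = [] := rfl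

/-- Unfolding lemma. [folklore] -/
@[simp] theorem subst_cons (P : ι → Word d) (x : ι × Bool) (ℓ : List (ι × Bool)) :
    subst P (x :: ℓ) = cond x.2 (P x.1) (Word.reverse (P x.1)) ++ subst P ℓ := rfl

end Word

/-- **Inversion of every generator, order of the letters kept** (`w(a,b) ↦ w(a⁻¹,b⁻¹)`; NOT `w ↦ w⁻¹`,
which would also reverse the order). [folklore] -/
def invLetters (ℓ : List (ι × Bool)) : List (ι × Bool) := ℓ.map fun x => (x.1, !x.2)

/-- `invLetters` is an involution. [folklore] -/
@[simp] theorem invLetters_invLetters (ℓ : List (ι × Bool)) : invLetters (invLetters ℓ) = ℓ := by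
  simp [invLetters, List.map_map, Function.comp_def]

/-- Evaluating the letters of `invLetters ℓ` at `f` is evaluating the letters of `ℓ` at `f⁻¹`. [folklore] -/
theorem map_eval_invLetters {G : Type*} [Group G] (f : ι → G) (ℓ : List (ι × Bool)) :
    ((invLetters ℓ).map fun x => cond x.2 (f x.1) (f x.1)⁻¹) =
      ℓ.map fun x => cond x.2 (f x.1)⁻¹ (f x.1)⁻¹⁻¹ := by
  rw [invLetters, List.map_map]
  refine List.map_congr_left fun x _ => ?_
  obtain ⟨i, b⟩ := x
  cases b <;> simp

/-- `FreeGroup.mk (invLetters ℓ)` evaluated at `f` is `FreeGroup.mk ℓ` evaluated at `f⁻¹`. [folklore] -/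
theorem lift_mk_invLetters {G : Type*} [Group G] (f : ι → G) (ℓ : List (ι × Bool)) :
    FreeGroup.lift f (FreeGroup.mk (invLetters ℓ)) = FreeGroup.lift (fun i => (f i)⁻¹) (FreeGroup.mk ℓ) := by
  rw [FreeGroup.lift_mk, FreeGroup.lift_mk, map_eval_invLetters]

/-! ## Torus: closedness and holonomy of substitution words -/

section Torus

variable {L : ℕ} {G : Type*} [Group G]

/-- A letter block `P i` or `reverse (P i)` of a loop closed at `x` returns to `x`. [folklore] -/
theorem Word.endpoint_cond_of_closed (x : Site d L) {p : Word d} (hp : Word.endpoint x p = x) (b : Bool) :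
    Word.endpoint x (cond b p (Word.reverse p)) = x := by
  cases b
  · have h := Word.endpoint_reverse x p
    rwa [hp] at h
  · exact hp

/-- **Substitution words of closed loops are closed.** [folklore] -/
theorem Word.endpoint_subst (x : Site d L) {P : ι → Word d} (hP : ∀ i, Word.endpoint x (P i) = x) :
    ∀ ℓ : List (ι × Bool), Word.endpoint x (Word.subst P ℓ) = x
  | [] => rfl
  | y :: ℓ => by
    rw [Word.subst_cons, Word.endpoint_append, Word.endpoint_cond_of_closed x (hP y.1), Word.endpoint_subst x hP ℓ]

/-- Holonomy of one letter block: `hol_x(P i)` or `hol_x(P i)⁻¹`. [folklore] -/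
theorem wordHolonomy_cond_of_closed (U : GaugeConfig d L G) (x : Site d L) {p : Word d}
    (hp : Word.endpoint x p = x) (b : Bool) :
    wordHolonomy U x (cond b p (Word.reverse p)) = cond b (wordHolonomy U x p) (wordHolonomy U x p)⁻¹ := by
  cases b
  · have h := wordHolonomy_reverse U x p
    rwa [hp] at h
  · rfl

/-- **The holonomy of a substitution word is the free-group evaluation of the letters at the loop
holonomies** (list form). [folklore] -/
theorem wordHolonomy_subst (U : GaugeConfig d L G) (x : Site d L) (P : ι → Word d)
    (hP : ∀ i, Word.endpoint x (P i) = x) : ∀ ℓ : List (ι × Bool),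
    wordHolonomy U x (Word.subst P ℓ) =
      (ℓ.map fun y => cond y.2 (wordHolonomy U x (P y.1)) (wordHolonomy U x (P y.1))⁻¹).prod
  | [] => by simp
  | y :: ℓ => by
    rw [Word.subst_cons, wordHolonomy_append, Word.endpoint_cond_of_closed x (hP y.1),
      wordHolonomy_cond_of_closed U x (hP y.1), wordHolonomy_subst U x P hP ℓ, List.map_cons, List.prod_cons]

/-- The same in `FreeGroup` form: `hol_x(subst P ℓ) = FreeGroup.lift (hol_x ∘ P) (FreeGroup.mk ℓ)`. [folklore] -/
theorem wordHolonomy_subst_eq_lift (U : GaugeConfig d L G) (x : Site d L) (P : ι → Word d)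
    (hP : ∀ i, Word.endpoint x (P i) = x) (ℓ : List (ι × Bool)) :
    wordHolonomy U x (Word.subst P ℓ) = FreeGroup.lift (fun i => wordHolonomy U x (P i)) (FreeGroup.mk ℓ) := by
  rw [FreeGroup.lift_mk, wordHolonomy_subst U x P hP]

end Torus

/-! ## `ℤ^d`: closedness and holonomy of substitution words -/

section Zd

variable {G : Type*} [Group G]

/-- A letter block of a loop closed at `x` returns to `x` (`ℤ^d`). [folklore] -/
theorem Word.endpointZd_cond_of_closed (x : Fin d → ℤ) {p : Word d} (hp : Word.endpointZd x p = x) (b : Bool) :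
    Word.endpointZd x (cond b p (Word.reverse p)) = x := by
  cases b
  · have h := Word.endpointZd_reverse x p
    rwa [hp] at h
  · exact hp

/-- Substitution words of closed loops are closed (`ℤ^d`). [folklore] -/
theorem Word.endpointZd_subst (x : Fin d → ℤ) {P : ι → Word d} (hP : ∀ i, Word.endpointZd x (P i) = x) :
    ∀ ℓ : List (ι × Bool), Word.endpointZd x (Word.subst P ℓ) = x
  | [] => rfl
  | y :: ℓ => by
    rw [Word.subst_cons, Word.endpointZd_append, Word.endpointZd_cond_of_closed x (hP y.1),
      Word.endpointZd_subst x hP ℓ]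

/-- Holonomy of one letter block (`ℤ^d`). [folklore] -/
theorem wordHolonomyZd_cond_of_closed (U : LGConfig d G) (x : Fin d → ℤ) {p : Word d}
    (hp : Word.endpointZd x p = x) (b : Bool) :
    wordHolonomyZd U x (cond b p (Word.reverse p)) = cond b (wordHolonomyZd U x p) (wordHolonomyZd U x p)⁻¹ := by
  cases b
  · have h := wordHolonomyZd_reverse U x p
    rwa [hp] at h
  · rfl

/-- The holonomy of a substitution word on `ℤ^d` (list form). [folklore] -/
theorem wordHolonomyZd_subst (U : LGConfig d G) (x : Fin d → ℤ) (P : ι → Word d)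
    (hP : ∀ i, Word.endpointZd x (P i) = x) : ∀ ℓ : List (ι × Bool),
    wordHolonomyZd U x (Word.subst P ℓ) =
      (ℓ.map fun y => cond y.2 (wordHolonomyZd U x (P y.1)) (wordHolonomyZd U x (P y.1))⁻¹).prod
  | [] => by simp
  | y :: ℓ => by
    rw [Word.subst_cons, wordHolonomyZd_append, Word.endpointZd_cond_of_closed x (hP y.1),
      wordHolonomyZd_cond_of_closed U x (hP y.1), wordHolonomyZd_subst U x P hP ℓ, List.map_cons, List.prod_cons]

/-- The same in `FreeGroup` form (`ℤ^d`). [folklore] -/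
theorem wordHolonomyZd_subst_eq_lift (U : LGConfig d G) (x : Fin d → ℤ) (P : ι → Word d)
    (hP : ∀ i, Word.endpointZd x (P i) = x) (ℓ : List (ι × Bool)) :
    wordHolonomyZd U x (Word.subst P ℓ) = FreeGroup.lift (fun i => wordHolonomyZd U x (P i)) (FreeGroup.mk ℓ) := by
  rw [FreeGroup.lift_mk, wordHolonomyZd_subst U x P hP]

end Zd

/-! ## `SU(2)`, two loops: simultaneous inversion of both loops is invisible -/

section SU2Torus

variable {L : ℕ}

/-- ★★ **One conjugator for all words** (torus): for `SU(2)`, two loops `P 0, P 1` closed at `x` and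
every configuration `U` there is `g ∈ SU(2)` with `hol_x(w(p⁻¹,q⁻¹)) = g · hol_x(w(p,q)) · g⁻¹` for ALL
letter lists `w`. [folklore] -/
theorem exists_conj_wordHolonomy_subst_invLetters (U : GaugeConfig d L (SU 2)) (x : Site d L)
    (P : Fin 2 → Word d) (hP : ∀ i, Word.endpoint x (P i) = x) : ∃ g : SU 2, ∀ ℓ : List (Fin 2 × Bool),
    wordHolonomy U x (Word.subst P (invLetters ℓ)) = g * wordHolonomy U x (Word.subst P ℓ) * g⁻¹ := by
  obtain ⟨g, hg⟩ := SU2PairInversion.exists_lift_inv_eq_conj (fun i => wordHolonomy U x (P i))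
  refine ⟨g, fun ℓ => ?_⟩
  rw [wordHolonomy_subst_eq_lift U x P hP, wordHolonomy_subst_eq_lift U x P hP, lift_mk_invLetters, hg]

/-- ★★ **Equal traces** (torus): `tr hol_x(w(p⁻¹,q⁻¹)) = tr hol_x(w(p,q))` for `SU(2)`, pointwise in
the configuration. [folklore] -/
theorem trace_wordHolonomy_subst_invLetters (U : GaugeConfig d L (SU 2)) (x : Site d L)
    (P : Fin 2 → Word d) (hP : ∀ i, Word.endpoint x (P i) = x) (ℓ : List (Fin 2 × Bool)) :
    ((wordHolonomy U x (Word.subst P (invLetters ℓ)) : SU 2) : Matrix (Fin 2) (Fin 2) ℂ).trace =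
      ((wordHolonomy U x (Word.subst P ℓ) : SU 2) : Matrix (Fin 2) (Fin 2) ℂ).trace := by
  rw [wordHolonomy_subst_eq_lift U x P hP, wordHolonomy_subst_eq_lift U x P hP, lift_mk_invLetters]
  exact SU2PairInversion.trace_lift_inv _ _

/-- ★★★ **`SU(2)` loop variables are blind to the simultaneous inversion of two generating loops**
(torus): `W_x(w(p⁻¹,q⁻¹)) = W_x(w(p,q))` AS FUNCTIONS of the configuration, for every word `w` and
every two loops `p = P 0`, `q = P 1` closed at `x`. [folklore] -/
theorem wordLoop_subst_invLetters (x : Site d L) (P : Fin 2 → Word d) (hP : ∀ i, Word.endpoint x (P i) = x)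
    (ℓ : List (Fin 2 × Bool)) :
    wordLoop (suRep 2) x (Word.subst P (invLetters ℓ)) = wordLoop (L := L) (suRep 2) x (Word.subst P ℓ) := by
  funext U
  rw [wordLoop_apply, wordLoop_apply, fundamentalRep_apply, fundamentalRep_apply,
    trace_wordHolonomy_subst_invLetters U x P hP ℓ]

/-- The two-loop spelling with `![p, q]`. [folklore] -/
theorem wordLoop_subst_pair_invLetters (x : Site d L) {p q : Word d} (hp : Word.endpoint x p = x)
    (hq : Word.endpoint x q = x) (ℓ : List (Fin 2 × Bool)) :
    wordLoop (suRep 2) x (Word.subst ![p, q] (invLetters ℓ)) = wordLoop (L := L) (suRep 2) x (Word.subst ![p, q] ℓ) :=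
  wordLoop_subst_invLetters x ![p, q] (fun i => by fin_cases i <;> assumption) ℓ

/-- ★★★ **Hence equal expectations in the Wilson state of every torus at every coupling** (and, the
identity being pointwise, in every other state as well). [folklore] -/
theorem wilsonExpectation_wordLoop_subst_invLetters [NeZero L] (β : ℝ) (x : Site d L) (P : Fin 2 → Word d)
    (hP : ∀ i, Word.endpoint x (P i) = x) (ℓ : List (Fin 2 × Bool)) :
    wilsonExpectation (suRep 2) β (wordLoop (suRep 2) x (Word.subst P (invLetters ℓ))) =
      wilsonExpectation (L := L) (suRep 2) β (wordLoop (suRep 2) x (Word.subst P ℓ)) := by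
  rw [wordLoop_subst_invLetters x P hP ℓ]

end SU2Torus

section SU2Zd

/-- ★★ One conjugator for all words (`ℤ^d`). [folklore] -/
theorem exists_conj_wordHolonomyZd_subst_invLetters (U : LGConfig d (SU 2)) (x : Fin d → ℤ)
    (P : Fin 2 → Word d) (hP : ∀ i, Word.endpointZd x (P i) = x) : ∃ g : SU 2, ∀ ℓ : List (Fin 2 × Bool),
    wordHolonomyZd U x (Word.subst P (invLetters ℓ)) = g * wordHolonomyZd U x (Word.subst P ℓ) * g⁻¹ := by
  obtain ⟨g, hg⟩ := SU2PairInversion.exists_lift_inv_eq_conj (fun i => wordHolonomyZd U x (P i))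
  refine ⟨g, fun ℓ => ?_⟩
  rw [wordHolonomyZd_subst_eq_lift U x P hP, wordHolonomyZd_subst_eq_lift U x P hP, lift_mk_invLetters, hg]

/-- ★★ Equal traces (`ℤ^d`). [folklore] -/
theorem trace_wordHolonomyZd_subst_invLetters (U : LGConfig d (SU 2)) (x : Fin d → ℤ)
    (P : Fin 2 → Word d) (hP : ∀ i, Word.endpointZd x (P i) = x) (ℓ : List (Fin 2 × Bool)) :
    ((wordHolonomyZd U x (Word.subst P (invLetters ℓ)) : SU 2) : Matrix (Fin 2) (Fin 2) ℂ).trace =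
      ((wordHolonomyZd U x (Word.subst P ℓ) : SU 2) : Matrix (Fin 2) (Fin 2) ℂ).trace := by
  rw [wordHolonomyZd_subst_eq_lift U x P hP, wordHolonomyZd_subst_eq_lift U x P hP, lift_mk_invLetters]
  exact SU2PairInversion.trace_lift_inv _ _

/-- ★★★ **`SU(2)` loop variables on `ℤ^d` are blind to the simultaneous inversion of two generating
loops**: `W_x(w(p⁻¹,q⁻¹)) = W_x(w(p,q))` as functions on `LGConfig d (SU 2)`; in particular equal
integrals against every measure (every DLR / Class-B state / thermodynamic limit point). [folklore] -/
theorem wordLoopZd_subst_invLetters (x : Fin d → ℤ) (P : Fin 2 → Word d) (hP : ∀ i, Word.endpointZd x (P i) = x)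
    (ℓ : List (Fin 2 × Bool)) :
    wordLoopZd (suRep 2) x (Word.subst P (invLetters ℓ)) = wordLoopZd (d := d) (suRep 2) x (Word.subst P ℓ) := by
  funext U
  rw [wordLoopZd_apply, wordLoopZd_apply, fundamentalRep_apply, fundamentalRep_apply,
    trace_wordHolonomyZd_subst_invLetters U x P hP ℓ]

/-- Equal integrals against any measure on `ℤ^d` configurations. [folklore] -/
theorem integral_wordLoopZd_subst_invLetters (μ : Measure (LGConfig d (SU 2))) (x : Fin d → ℤ)
    (P : Fin 2 → Word d) (hP : ∀ i, Word.endpointZd x (P i) = x) (ℓ : List (Fin 2 × Bool)) :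
    ∫ U, wordLoopZd (suRep 2) x (Word.subst P (invLetters ℓ)) U ∂μ = ∫ U, wordLoopZd (suRep 2) x (Word.subst P ℓ) U ∂μ := by
  rw [wordLoopZd_subst_invLetters x P hP ℓ]

end SU2Zd

end Summit.QuantumFields.GaugeBoot

end
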